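import Literature.Computability.QuantumComplexity.ZWRing
import HarnessLib

/-!
# The `p`-blocked simulator of Jozsa–Linden as a functional program on typed data

Topic `Literature/Barriers/QuantumAdvantage`; first file of the *machine half* of the proof programme for
the named fact `Literature.Barriers.QuantumAdvantage.jozsaLinden2003_pblocked` (Jozsa–Linden 2003, §3,
lemma `ratpbl` / theorem `pblthm`). The quantum half (`BoundedEntanglement*.lean`) reduced the fact to
"the decision bit `pDecision F x` is computable in polynomial time" (`jozsaLinden2003_pblocked_of_decisionInFP`,
`BoundedEntanglementReadout.lean`) and characterised everything the classical machine computes by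
identities in `ℤ[ω]`-coordinates (`BoundedEntanglementGramZUpdate.lean`). This file writes that machine
as an ordinary total functional program on typed data — to be certified polynomial-time by the typed
combinators of `Complexity/CodeFP.lean` (`PBlockedSimCodeFP.lean`) and proved to compute the canonical
block data (`PBlockedSimSpec.lean`). No string function appears here.

Layout (all wire sets and configurations are `N`-bit lists, wire `0` first): a block is a mask with
its table of integral Gram data indexed by pairs of configurations supported in the mask
("(a) block locations, (b) block states"); the state is the integer `D = 2^h` (`h` the number of
Hadamard gates so far) and the list of blocks. One gate: collect the blocks meeting its wires, merge
their tables (product, exact division by `D`), conjugate by the rescaled gate, double the other tables at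
a Hadamard gate, find the finest block structure inside the merged wires by split tests on a column of
nonzero diagonal entry, and read the new tables off by partial traces — Jozsa–Linden's Cases 1 and 2.
Two caps keep the program polynomial on *every* input (they are inert on `p`-blocked computations):
merged wire sets of more than `2p` wires are not processed, and every produced coordinate is saturated
at a width `W`.

* bit lists: `band`, `bor`, `bandnot`, `zeros`, `oneHot`, `pw` (gluing along a mask), `popcount`,
  `deposit`, `subCfgs p m` (the configurations supported in `m`, at most `4^p` of them);
* tables: `lookup`, `mkTab`, `sumZ`, `capZ`, `divZ`; the rescaled gate coefficients `coef`
  (`√2·H`, `S`, `T`, `CNOT` in `ℤ[ω]`), `setAt`/`setLocal`, `gateEntry`/`gateTab`, `mergeTab`, `traceEntry`;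
* re-blocking: `firstNonzeroDiag`, `splitsTest`, `classOf`, `dedupL`, `newBlocks`;
* the machine: `Ctx` (`p`, `N`, `W`), `touchingL`/`untouchedL`, `roundSim`, `initBlocks`, `runSim`,
  `readout`, `simDecide`.

## References

* R. Jozsa, N. Linden, *On the role of entanglement in quantum-computational speed-up*, Proc. R. Soc.
  Lond. A 459 (2003) 2011–2032, arXiv:quant-ph/0201143: §3, proof of lemma `ratpbl` ((a), (b), Cases
  1 and 2, the final read-out), theorem `pblthm`; §2 (decision version).
-/

namespace Literature.Barriers.QuantumAdvantage

namespace PSim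

open Literature.Computability.QuantumComplexity

/-! ### Bit lists: masks and configurations -/

/-- Configurations and wire masks: `N`-bit lists, wire `0` first. [cite: JozsaLinden2003, §3 (proof of lemma ratpbl, (a) block locations)] -/
abbrev Cfg : Type := List Bool

/-- Bitwise `and`. [folklore] -/
def band (a b : Cfg) : Cfg := List.zipWith (fun x y => x && y) a b
/-- Bitwise `or`. [folklore] -/
def bor (a b : Cfg) : Cfg := List.zipWith (fun x y => x || y) a b
/-- Bitwise `a ∧ ¬b`. [folklore] -/
def bandnot (a b : Cfg) : Cfg := List.zipWith (fun x y => x && !y) a b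
/-- The all-zero list of length `N`. [folklore] -/
def zeros (N : ℕ) : Cfg := List.replicate N false
/-- The list of length `N` with a single `1` at position `i`. [folklore] -/
def oneHot (N i : ℕ) : Cfg := (List.range N).map fun k => decide (k = i)
/-- Gluing along a mask: `pw S u v` is `u` on `S` and `v` off `S` (`S.piecewise u v`). [folklore] -/
def pw (S u v : Cfg) : Cfg := bor (band u S) (bandnot v S)
/-- The number of set bits. [folklore] -/
def popcount (m : Cfg) : ℕ := m.count true

/-- `deposit k m`: the configuration supported in the mask `m` whose bits on the set positions of `m`
are the binary digits of `k` (least significant first). [folklore] -/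
def deposit : ℕ → Cfg → Cfg
  | _, [] => []
  | k, false :: m => false :: deposit k m
  | k, true :: m => decide (k % 2 = 1) :: deposit (k / 2) m

/-- **The configurations supported in a mask**, `deposit k m` for `k < 2^{popcount m}` — at most `4^p`
of them (the cap: a mask of more than `2p` set bits, which never occurs on a `p`-blocked computation, is
enumerated only partially). [cite: JozsaLinden2003, §3 (proof of lemma ratpbl, (b): "at most 2^{p+1} real numbers since each block has size at most p")] -/
def subCfgs (p : ℕ) (m : Cfg) : List Cfg :=
  (List.range (min (2 ^ popcount m) (4 ^ p))).map fun k => deposit k m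

/-! ### Tables of `ℤ[ω]` data indexed by pairs of configurations -/

/-- A table: an association list from pairs of configurations to elements of `ℤ[ω]`. [cite: JozsaLinden2003, §3 (proof of lemma ratpbl, (b) block states)] -/
abbrev Tab : Type := List ((Cfg × Cfg) × ZW)

/-- A block: its wire mask and its table. [cite: JozsaLinden2003, §3 (proof of lemma ratpbl, (a), (b))] -/
abbrev Blk : Type := Cfg × Tab

/-- Lookup of a key (the last matching entry; `0` if absent). [folklore] -/
def lookup (T : Tab) (key : Cfg × Cfg) : ZW :=
  T.foldl (fun acc e => if e.1 = key then e.2 else acc) 0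

/-- The table of a function on `keys × keys`. [folklore] -/
def mkTab (keys : List Cfg) (f : Cfg → Cfg → ZW) : Tab :=
  (keys.map fun u => keys.map fun v => ((u, v), f u v)).flatten

/-- Sum of a list of elements of `ℤ[ω]` (a left fold). [folklore] -/
def sumZ (l : List ZW) : ZW := l.foldl (fun acc z => acc + z) 0

/-- Saturation of coordinates at width `W`. [folklore] -/
def capZ (W : ℕ) (z : ZW) : ZW := fun k => if (z k).natAbs < 2 ^ W then z k else 0

/-- Coordinatewise integer division. [folklore] -/
def divZ (D : ℤ) (z : ZW) : ZW := fun k => z k / D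

/-! ### The rescaled gates and the three table operations -/

/-- **The rescaled gate coefficients in `ℤ[ω]`** for the gate symbol with number `op`
(`0 = H`, `1 = S`, `2 = T`, `3 = CNOT`, the `Encodable` numbering of `CliffordTOp`), row bits `x₀, x₁` and
column bits `y₀, y₁` on the gate's wires (first wire = control for `CNOT`; the second bits are ignored
for one-qubit gates): `√2·H = [[1,1],[1,-1]]`, `S = diag(1, ω²)`, `T = diag(1, ω)`,
`CNOT = [x₀ = y₀ ∧ x₁ = y₁ ⊕ y₀]` (cf. `gateZ`, `BoundedEntanglementIntegral.lean`). [cite: JozsaLinden2003, §3 (eq. (update))] -/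
def coef (op : ℕ) (x₀ x₁ y₀ y₁ : Bool) : ZW :=
  if op = 0 then (if x₀ && y₀ then -ZW.one else ZW.one)
  else if op = 1 then (if x₀ = y₀ then (if x₀ then ZW.mulOmegaPow 2 ZW.one else ZW.one) else 0)
  else if op = 2 then (if x₀ = y₀ then (if x₀ then ZW.mulOmegaPow 1 ZW.one else ZW.one) else 0)
  else (if x₀ = y₀ ∧ x₁ = (y₁ ^^ y₀) then ZW.one else 0)

/-- The two bits. [folklore] -/
def bools : List Bool := [false, true]

/-- The local configurations summed over in a gate step: both bits for `CNOT`, the first bit (second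
`false`) for one-qubit gates. [folklore] -/
def localCfgs (op : ℕ) : List (Bool × Bool) :=
  if op = 3 then (bools.map fun a => bools.map fun a' => (a, a')).flatten else bools.map fun a => (a, false)

/-- Overwriting position `i` of a list (by `take`/`drop`; junk — an appended bit — past the end, which
does not occur on wire indices `< N`). [folklore] -/
def setAt (u : Cfg) (i : ℕ) (a : Bool) : Cfg := u.take i ++ [a] ++ u.drop (i + 1)

/-- Writing the local bits of a gate into a configuration (second wire only for `CNOT`). [folklore] -/
def setLocal (op i j : ℕ) (u : Cfg) (a : Bool × Bool) : Cfg :=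
  if op = 3 then setAt (setAt u i a.1) j a.2 else setAt u i a.1

/-- **One gate on the Gram data of the merged wires**: `D'(u, v) = Σ_{a, b} V(u; a) · D(u[E↦a], v[E↦b]) · conj V(v; b)`
(`ρ_C ↦ V ρ_C V†` with the rescaled gate `V`). [cite: JozsaLinden2003, §3 (proof of lemma ratpbl, Cases 1 and 2: "applying a unitary matrix")] -/
def gateEntry (op i j : ℕ) (T : Tab) (u v : Cfg) : ZW :=
  sumZ ((localCfgs op).map fun a => sumZ ((localCfgs op).map fun b =>
    ZW.mul (ZW.mul (coef op (u.getD i false) (u.getD j false) a.1 a.2)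
      (lookup T (setLocal op i j u a, setLocal op i j v b)))
      (ZW.cconj (coef op (v.getD i false) (v.getD j false) b.1 b.2))))

/-- The table of the merged wires after the gate, saturated at width `W`. [cite: JozsaLinden2003, §3 (proof of lemma ratpbl, Cases 1 and 2)] -/
def gateTab (W op i j : ℕ) (keys : List Cfg) (T : Tab) : Tab :=
  mkTab keys fun u v => capZ W (gateEntry op i j T u v)

/-- **Merging two blocks**: the datum of the union is the product of the data of the parts, divided
exactly by `D = 2^h` (`ρ_{B₁ ∪ B₂} = ρ_{B₁} ⊗ ρ_{B₂}`; `gramZ_union_ampZ`). [cite: JozsaLinden2003, §3 (proof of lemma ratpbl, Case 2: "amalgamating the two block labels")] -/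
def mergeTab (W : ℕ) (D : ℤ) (B₁ : Cfg) (T₁ : Tab) (B₂ : Cfg) (T₂ : Tab) (keys : List Cfg) : Tab :=
  mkTab keys fun u v => capZ W (divZ D
    (ZW.mul (lookup T₁ (band u B₁, band v B₁)) (lookup T₂ (band u B₂, band v B₂))))

/-- **Partial trace**: the datum of `A ⊆ C` at `(u, v)` is the sum of the `C`-data over a common
configuration of `C ∖ A` glued onto both (`gramZ_eq_sum_gramZ`). [cite: JozsaLinden2003, §3 (proof of lemma ratpbl, Case 2: "compute the reduced state ρ_X of every subset")] -/
def traceEntry (p : ℕ) (C A : Cfg) (T : Tab) (u v : Cfg) : ZW :=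
  sumZ ((subCfgs p (bandnot C A)).map fun t => lookup T (bor u t, bor v t))

/-! ### Re-blocking inside the merged wires -/

/-- The first configuration of the list with a nonzero diagonal entry (the zero list if none). [folklore] -/
def firstNonzeroDiag (N : ℕ) (keys : List Cfg) (T : Tab) : Cfg :=
  (keys.foldl (fun acc u => if acc.1 then acc else if lookup T (u, u) = 0 then acc else (true, u)) (false, zeros N)).2

/-- **The split test of a sub-mask `S`** on the column `u ↦ T(u, y₀)`: all rank-one identities
`col u · col v = col (u|_S, v) · col (v|_S, u)` hold (`splits_stateAfter_iff_columnZ`). [cite: JozsaLinden2003, §3 (proof of lemma ratpbl, Case 2: "looking for an equality of states")] -/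
def splitsTest (keys : List Cfg) (T : Tab) (y₀ S : Cfg) : Bool :=
  keys.all fun u => keys.all fun v =>
    decide (ZW.mul (lookup T (u, y₀)) (lookup T (v, y₀)) =
      ZW.mul (lookup T (pw S u v, y₀)) (lookup T (pw S v u, y₀)))

/-- **The new block of a wire**: the intersection of the splitting sub-masks containing it (the atom
of the wire in the new state, `mem_atom_stateAfter_succ_iff`). [cite: JozsaLinden2003, §3 (proof of lemma ratpbl, Case 2: "identify a new block structure")] -/
def classOf (C : Cfg) (splitting : List Cfg) (a : ℕ) : Cfg :=
  splitting.foldl (fun acc S => if S.getD a false then band acc S else acc) C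

/-- Removing duplicates, keeping first occurrences. [folklore] -/
def dedupL (l : List Cfg) : List Cfg :=
  l.foldl (fun acc a => if a ∈ acc then acc else acc ++ [a]) []

/-- **The new blocks inside the merged wires `C`** with their tables (partial traces of the gated
table `T`). [cite: JozsaLinden2003, §3 (proof of lemma ratpbl, Case 2)] -/
def newBlocks (p N W : ℕ) (C : Cfg) (keys : List Cfg) (T : Tab) : List Blk :=
  let y₀ := firstNonzeroDiag N keys T
  let splitting := (subCfgs p C).filter fun S => splitsTest keys T y₀ S
  let classes := dedupL (((List.range N).filter fun a => C.getD a false).map fun a => classOf C splitting a)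
  classes.map fun A => (A, mkTab (subCfgs p A) fun u v => capZ W (traceEntry p C A T u v))

/-! ### The machine -/

/-- The parameters of a run: the block-size bound `p`, the number of wires `N`, the saturation width `W`.
[cite: JozsaLinden2003, §3 (theorem pblthm)] -/
structure Ctx where
  /-- the block-size bound of theorem `pblthm` -/
  p : ℕ
  /-- the number of wires -/
  N : ℕ
  /-- the saturation width of coordinates -/
  W : ℕ

/-- Does the block's mask meet the wires of the gate? [folklore] -/
def touches (op i j : ℕ) (b : Blk) : Bool :=
  b.1.getD i false || (decide (op = 3) && b.1.getD j false)

/-- The blocks meeting the wires of the gate ("touching"). [cite: JozsaLinden2003, §3 (proof of lemma ratpbl, Cases 1 and 2)] -/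
def touchingL (op i j : ℕ) (blocks : List Blk) : List Blk := blocks.filter fun b => touches op i j b

/-- The other blocks. [cite: JozsaLinden2003, §3 (proof of lemma ratpbl, Cases 1 and 2)] -/
def untouchedL (op i j : ℕ) (blocks : List Blk) : List Blk := blocks.filter fun b => !touches op i j b

/-- Doubling a table (the data of an untouched block at a Hadamard gate, `gramZ_ampZ_succ_of_disjoint`),
saturated. [cite: JozsaLinden2003, §3 (proof of lemma ratpbl, Cases 1 and 2)] -/
def doubleTab (W : ℕ) (T : Tab) : Tab := T.map fun e => (e.1, capZ W (e.2 + e.2))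

/-- **One gate of the simulation** on the state `(D, blocks)` for the gate `(op, i, j)`: merge the
touching blocks, apply the gate, double the others at a Hadamard gate (and `D`), re-block the merged wires.
Junk gates (not meeting one or two blocks, or merging more than `2p` wires) leave the state unchanged.
[cite: JozsaLinden2003, §3 (proof of lemma ratpbl, Cases 1 and 2)] -/
def roundSim (c : Ctx) (st : ℤ × List Blk) (g : ℕ × ℕ × ℕ) : ℤ × List Blk :=
  let D := st.1
  let blocks := st.2
  let op := g.1
  let i := g.2.1
  let j := g.2.2
  let tch := touchingL op i j blocks
  let rest := untouchedL op i j blocks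
  let C := tch.foldl (fun acc b => bor acc b.1) (zeros c.N)
  if (tch.length = 1 ∨ tch.length = 2) ∧ popcount C ≤ 2 * c.p then
    let keys := subCfgs c.p C
    let B₁ := (tch.getD 0 (zeros c.N, [])).1
    let T₁ := (tch.getD 0 (zeros c.N, [])).2
    let B₂ := (tch.getD 1 (zeros c.N, [])).1
    let T₂ := (tch.getD 1 (zeros c.N, [])).2
    let TC := if tch.length = 1 then T₁ else mergeTab c.W D B₁ T₁ B₂ T₂ keys
    let T' := gateTab c.W op i j keys TC
    let D' := if op = 0 then D + D else D
    let rest' := if op = 0 then rest.map (fun b => (b.1, doubleTab c.W b.2)) else rest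
    (D', rest' ++ newBlocks c.p c.N c.W C keys T')
  else st

/-- **The initial blocks**: singletons, with the Gram data of the input basis state `w₀`
(`T(u, v) = [u_i = w₀ i][v_i = w₀ i]` on the two configurations of wire `i`). [cite: JozsaLinden2003, §3 (proof of lemma ratpbl: the input row |i₁…iₙ⟩|0…0⟩)] -/
def initBlocks (N : ℕ) (w₀ : Cfg) : List Blk :=
  (List.range N).map fun i => (oneHot N i,
    mkTab [zeros N, oneHot N i] fun u v =>
      if u.getD i false = w₀.getD i false ∧ v.getD i false = w₀.getD i false then ZW.one else 0)

/-- The whole run over a gate list from the initial state `(1, initBlocks)`. [cite: JozsaLinden2003, §3 (proof of lemma ratpbl)] -/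
def runSim (c : Ctx) (w₀ : Cfg) (gates : List (ℕ × ℕ × ℕ)) : ℤ × List Blk :=
  gates.foldl (fun st g => roundSim c st g) (1, initBlocks c.N w₀)

/-- **The read-out**: the block whose mask contains wire `0`, the diagonal sum over its configurations
with bit `0` set, and the exact sign test `[0 < (2d₀ - D) + 2d₁√2]` (`pDecision`); `false` on the empty
register. [cite: JozsaLinden2003, §3 (proof of lemma ratpbl, final step: "identify the block containing the leftmost qubit")] -/
def readout (c : Ctx) (st : ℤ × List Blk) : Bool :=
  if c.N = 0 then false else
    let b := (st.2.filter fun b => b.1.getD 0 false).getD 0 (zeros c.N, [])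
    let d := sumZ (((subCfgs c.p b.1).filter fun u => u.getD 0 false).map fun u => lookup b.2 (u, u))
    posSqrtTwoTest (2 * d 0 - st.1) (2 * d 1)

/-- **The decision bit of the simulation** for block bound `p`, saturation width `W`, `n` input wires,
`m` ancillas, gate list and input `x`. [cite: JozsaLinden2003, §3 (theorem pblthm) with §2] -/
def simDecide (p W n m : ℕ) (gates : List (ℕ × ℕ × ℕ)) (x : List Bool) : Bool :=
  let c : Ctx := ⟨p, n + m, W⟩
  readout c (runSim c (x ++ zeros m) gates)

end PSim

end Literature.Barriers.QuantumAdvantage
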